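import Summits.SmoothPoincare4.SmoothPoincare4.Theses.WeylBudget
import Summits.SmoothPoincare4.SmoothPoincare4.Theorems.WeylBudgetBudgetTransfer
import Literature.Topology.FourManifolds.BoundaryGluingConstruction
import Literature.Topology.FourManifolds.CollarReparamCalculus
import HarnessLib

/-!
# Stub `stub_weylAdditivity` of crux `CorkRegluingBudget` (line `registered`, RESHAPE 4)

The Weyl energy of an isometric two-piece gluing is at most the sum over the pieces: if the closed
4-manifold `P` is covered by smooth embeddings `jC : C → P`, `jW : W → P` of compact pieces meeting
only along `∂C`-images, and `g`, `g_C`, `g_W` are Riemannian with `jC^* g = g_C`, `jW^* g = g_W`,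
then `𝒲(g) ≤ 𝒲(g_C) + 𝒲(g_W)` — the calculation of the landed `budgetTransfer_proof`
(`Theorems/WeylBudgetBudgetTransfer.lean`: null seams `riemannianMeasure_image_boundary_eq_zero`,
pointwise naturality `weylNormSq_eq_of_pullbackBilin_eq`, change of variables along injective local
isometries `setLIntegral_range_of_localIsometry` / `comap_riemannianMeasure_of_localIsometry`),
with the pieces themselves, through their boundaryless interiors, as the source:

* `isLocalDiffeomorph_interiorVal` — the inclusion `val : M - ∂M → M` of the boundaryless interior
  (`Literature.Topology.FourManifolds.InteriorManifold`, Bröcker–Jänich 1982, (13.3)) is a `C^∞`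
  local diffeomorphism (a diffeomorphism onto the open set of interior points, inverted by `ofPt`);
* `setLIntegral_image_interior_le` — **the piece inequality**
  `∫_{j(Int M)} f_P dV_g ≤ ∫_M f_M dV_{g_M}` for a smooth injective `j : M → P` with injective
  differential, `j^* g = g_M` and `f_P ∘ j = f_M`: with the boundaryless interior `M° = M - ∂M` and
  its metric `val^* g_M`, both `val : M° → M` and `j ∘ val : M° → P` are injective `C^∞` local
  isometries, so `∫_{j(Int M)} f_P dV_g = ∫_{M°} f_M ∘ val dV_{val^* g_M} = ∫_{Int M} f_M dV_{g_M}`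
  (Lee 2018, Prop. 2.51; Federer 1969, §2.10.11), which is at most `∫_M f_M dV_{g_M}`;
* `stub_weylAdditivity` — cover `P` by `jC(Int C)`, `jW(Int W)` and the null seams
  `jC(∂C) ∪ jW(∂W)`, and apply the piece inequality to `|W_g|² ∘ jC = |W_{g_C}|²`,
  `|W_g|² ∘ jW = |W_{g_W}|²` (O'Neill 1983, Ch. 3, Prop. 3.59).

Everything here is proved; no definitions, no named facts.

## References

* H. Federer, *Geometric Measure Theory* (1969), §2.10.11, §3.2.3. [Federer1969]
* J. M. Lee, *Introduction to Riemannian Manifolds*, 2nd ed. (2018), Prop. 2.51. [Lee2018]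
* B. O'Neill, *Semi-Riemannian geometry* (1983), Ch. 3, Prop. 3.59. [ONeill1983]
* T. Bröcker, K. Jänich, *Introduction to Differential Topology* (1982), (13.3). [BrockerJanich1982]
-/

-- the registered namespace `Summit.SmoothPoincare4.SmoothPoincare4.Theorems` repeats a component
set_option linter.dupNamespace false

open scoped Manifold ContDiff Topology ENNReal
open Set Function MeasureTheory

noncomputable section

namespace Summit.SmoothPoincare4.SmoothPoincare4.Theorems.CorkRegluingBudget

open Literature.Topology.FourManifolds Literature.Geometry.Lorentzian
  Literature.Geometry.Lorentzian.PseudoRiemannianMetric Literature.Geometry.Riemannian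
  Summit.SmoothPoincare4.SmoothPoincare4.Theorems.BudgetTransfer

/-! ### The inclusion of the interior is a local diffeomorphism -/

/-- **The inclusion `val : M - ∂M → M` of the boundaryless interior is a `C^∞` local
diffeomorphism**: it is a diffeomorphism onto the open set `Int M` of interior points, with inverse
the map `ofPt x` (the identity on interior points), which is smooth there because a map into the
interior is smooth iff it is smooth as a map into `M` (`InteriorManifold.contMDiffOn_iff_comp_val`).
[cite: BrockerJanich1982, (13.3)] -/
theorem isLocalDiffeomorph_interiorVal {E H : Type*} [NormedAddCommGroup E] [NormedSpace ℝ E]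
    [TopologicalSpace H] {I : ModelWithCorners ℝ E H} {M : Type*} [TopologicalSpace M]
    [ChartedSpace H M] [IsManifold I ∞ M] :
    IsLocalDiffeomorph 𝓘(ℝ, E) I ∞ (InteriorManifold.val : InteriorManifold I M → M) := by
  intro x
  have hinv : ContMDiffOn I 𝓘(ℝ, E) ∞ (InteriorManifold.ofPt x) (I.interior M) := by
    rw [InteriorManifold.contMDiffOn_iff_comp_val]
    exact contMDiffOn_id.congr fun m hm ↦ InteriorManifold.ofPt_val_of_isInteriorPoint x hm
  let Φ : PartialDiffeomorph 𝓘(ℝ, E) I (InteriorManifold I M) M ∞ :=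
    { toFun := InteriorManifold.val
      invFun := InteriorManifold.ofPt x
      source := univ
      target := I.interior M
      map_source' := fun y _ ↦ y.property
      map_target' := fun _ _ ↦ mem_univ _
      left_inv' := fun y _ ↦ InteriorManifold.val_injective
        (InteriorManifold.ofPt_val_of_isInteriorPoint x y.property)
      right_inv' := fun m hm ↦ InteriorManifold.ofPt_val_of_isInteriorPoint x hm
      open_source := isOpen_univ
      open_target := InteriorManifold.isOpen_interior_carrier
      contMDiffOn_toFun := InteriorManifold.contMDiff_val.contMDiffOn
      contMDiffOn_invFun := hinv }
  exact ⟨Φ, mem_univ x, fun _ _ ↦ rfl⟩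

/-! ### The piece inequality -/

/-- **The piece inequality `∫_{j(Int M)} f_P dV_g ≤ ∫_M f_M dV_{g_M}`.** Let `M` be a manifold
with boundary modelled on the half-space `ℝ⁴_{x₀ ≥ 0}`, `P` a boundaryless `4`-manifold, `j : M → P`
smooth and injective with injective differential, `g_M`, `g` Riemannian metrics with `j^* g = g_M`,
and `f_P ∘ j = f_M`. On the boundaryless interior `M° = M - ∂M` with the metric `val^* g_M`, the
inclusion `val : M° → M` (`isLocalDiffeomorph_interiorVal`) and `j ∘ val : M° → P` (inverse function
theorem, `isLocalDiffeomorphAt_of_injective`) are injective `C^∞` local isometries, hence measure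
preserving (`setLIntegral_range_of_localIsometry`, Lee 2018, Prop. 2.51; Federer 1969, §2.10.11):
`∫_{j(Int M)} f_P dV_g = ∫_{M°} f_P ∘ j ∘ val dV_{val^* g_M} = ∫_{Int M} f_M dV_{g_M}`, which is at
most `∫_M f_M dV_{g_M}`. [cite: Lee2018, Prop. 2.51] [cite: Federer1969, §2.10.11] -/
theorem setLIntegral_image_interior_le
    {M : Type*} [TopologicalSpace M] [T3Space M] [SecondCountableTopology M]
    [ChartedSpace (EuclideanHalfSpace 4) M] [IsManifold (𝓡∂ 4) ∞ M]
    [MeasurableSpace M] [BorelSpace M]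
    {P : Type*} [TopologicalSpace P] [T3Space P] [ChartedSpace (EuclideanSpace ℝ (Fin 4)) P]
    [IsManifold (𝓡 4) ∞ P] [MeasurableSpace P] [BorelSpace P]
    {gM : PseudoRiemannianMetric (𝓡∂ 4) ∞ (EuclideanSpace ℝ (Fin 4))
      (TangentSpace (𝓡∂ 4) : M → Type _)}
    {g : PseudoRiemannianMetric (𝓡 4) ∞ (EuclideanSpace ℝ (Fin 4))
      (TangentSpace (𝓡 4) : P → Type _)}
    {j : M → P} (hgM : gM.IsRiemannian) (hg : g.IsRiemannian)
    (hj : ContMDiff (𝓡∂ 4) (𝓡 4) ∞ j) (hj' : ∀ m, Injective (mfderiv (𝓡∂ 4) (𝓡 4) j m))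
    (hjinj : Injective j)
    (hiso : ∀ m, pullbackBilin (I := 𝓡 4) (I' := 𝓡∂ 4) j g.val m = gM.val m)
    {fP : P → ℝ≥0∞} {fM : M → ℝ≥0∞} (hf : ∀ m, fP (j m) = fM m) :
    ∫⁻ x in j '' (𝓡∂ 4).interior M, fP x ∂(riemannianMeasure (g.toContMDiffRiemannianMetric hg)) ≤
      ∫⁻ m, fM m ∂(riemannianMeasure (gM.toContMDiffRiemannianMetric hgM)) := by
  -- the boundaryless interior `M°`, Borel, locally compact (hence `T₃`)
  letI : MeasurableSpace (InteriorManifold (𝓡∂ 4) M) := borel _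
  haveI : BorelSpace (InteriorManifold (𝓡∂ 4) M) := ⟨rfl⟩
  haveI : LocallyCompactSpace (InteriorManifold (𝓡∂ 4) M) :=
    Manifold.locallyCompact_of_finiteDimensional (𝓡 4)
  -- the inclusion `val : M° → M` and the metric `val^* g_M`
  set ι : InteriorManifold (𝓡∂ 4) M → M := InteriorManifold.val with hι
  have hιs : ContMDiff (𝓡 4) (𝓡∂ 4) ∞ ι := InteriorManifold.contMDiff_val
  have hι' : ∀ a, Injective (mfderiv (𝓡 4) (𝓡∂ 4) ι a) := fun a ↦
    injective_mfderiv_interiorVal a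
  have hιinj : Injective ι := InteriorManifold.val_injective
  set γ := gM.comap contMDiff_pullbackBilin_holds ι (contMDiff_infty_add_one hιs) hι' rfl with hγ
  have hγR : γ.IsRiemannian := fun a v hv ↦ by
    simp only [hγ, val_comap, pullbackBilin_apply]
    exact hgM (ι a) _ fun h0 ↦ hv (hι' a (by rw [map_zero]; exact h0))
  have hιiso : ∀ (a : InteriorManifold (𝓡∂ 4) M) (v w : TangentSpace (𝓡 4) a),
      gM.val (ι a) (mfderiv (𝓡 4) (𝓡∂ 4) ι a v) (mfderiv (𝓡 4) (𝓡∂ 4) ι a w) = γ.val a v w :=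
    fun a v w ↦ by rw [hγ, val_comap, pullbackBilin_apply]
  -- change of variables along `val : M° → M`
  have hA : ∫⁻ m in range ι, fM m ∂(riemannianMeasure (gM.toContMDiffRiemannianMetric hgM)) =
      ∫⁻ a, fM (ι a) ∂(riemannianMeasure (γ.toContMDiffRiemannianMetric hγR)) :=
    setLIntegral_range_of_localIsometry hγR hgM hιs hιinj isLocalDiffeomorph_interiorVal hιiso
      rfl fM
  -- the composite `j ∘ val : M° → P` is an injective `C^∞` local isometry
  have hFs : ContMDiff (𝓡 4) (𝓡 4) ∞ (j ∘ ι) := hj.comp hιs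
  have hFinj : Injective (j ∘ ι) := hjinj.comp hιinj
  have hFd : ∀ a, mfderiv (𝓡 4) (𝓡 4) (j ∘ ι) a =
      (mfderiv (𝓡∂ 4) (𝓡 4) j (ι a)).comp (mfderiv (𝓡 4) (𝓡∂ 4) ι a) := fun a ↦
    mfderiv_comp a ((hj (ι a)).mdifferentiableAt (by simp)) ((hιs a).mdifferentiableAt (by simp))
  have hF' : ∀ a, Injective (mfderiv (𝓡 4) (𝓡 4) (j ∘ ι) a) := fun a ↦ by
    rw [hFd a]
    exact (hj' (ι a)).comp (hι' a)
  have hFloc : IsLocalDiffeomorph (𝓡 4) (𝓡 4) ∞ (j ∘ ι) := fun a ↦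
    isLocalDiffeomorphAt_of_injective isOpen_univ (mem_univ a) hFs.contMDiffOn (hF' a)
  have hFd' : ∀ (a : InteriorManifold (𝓡∂ 4) M) (v : TangentSpace (𝓡 4) a),
      mfderiv (𝓡 4) (𝓡 4) (j ∘ ι) a v =
        mfderiv (𝓡∂ 4) (𝓡 4) j (ι a) (mfderiv (𝓡 4) (𝓡∂ 4) ι a v) := fun a v ↦ by
    rw [hFd a]
    rfl
  have hFiso : ∀ (a : InteriorManifold (𝓡∂ 4) M) (v w : TangentSpace (𝓡 4) a),
      g.val ((j ∘ ι) a) (mfderiv (𝓡 4) (𝓡 4) (j ∘ ι) a v) (mfderiv (𝓡 4) (𝓡 4) (j ∘ ι) a w) =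
        γ.val a v w := fun a v w ↦ by
    rw [hFd' a v, hFd' a w, ← hιiso a v w, ← hiso (ι a), pullbackBilin_apply]
    rfl
  -- change of variables along `j ∘ val : M° → P`
  have hB : ∫⁻ x in range (j ∘ ι), fP x ∂(riemannianMeasure (g.toContMDiffRiemannianMetric hg)) =
      ∫⁻ a, fP ((j ∘ ι) a) ∂(riemannianMeasure (γ.toContMDiffRiemannianMetric hγR)) :=
    setLIntegral_range_of_localIsometry hγR hg hFs hFinj hFloc hFiso rfl fP
  have hrange : j '' (𝓡∂ 4).interior M = range (j ∘ ι) := by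
    rw [range_comp, hι, InteriorManifold.range_val]
  calc ∫⁻ x in j '' (𝓡∂ 4).interior M, fP x ∂(riemannianMeasure (g.toContMDiffRiemannianMetric hg))
      = ∫⁻ a, fP ((j ∘ ι) a) ∂(riemannianMeasure (γ.toContMDiffRiemannianMetric hγR)) := by
        rw [hrange, hB]
    _ = ∫⁻ a, fM (ι a) ∂(riemannianMeasure (γ.toContMDiffRiemannianMetric hγR)) :=
        lintegral_congr fun a ↦ hf (ι a)
    _ = ∫⁻ m in range ι, fM m ∂(riemannianMeasure (gM.toContMDiffRiemannianMetric hgM)) := hA.symm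
    _ ≤ ∫⁻ m, fM m ∂(riemannianMeasure (gM.toContMDiffRiemannianMetric hgM)) :=
        setLIntegral_le_lintegral _ _

/-! ### The stub -/

/-- **Additivity of the Weyl energy over an isometric two-piece gluing** (registered stub
`stub_weylAdditivity` of crux `CorkRegluingBudget`, line `registered` RESHAPE 4): see the module
docstring: cover `P` by the open pieces `jC(Int C)`, `jW(Int W)` and the null seams
`jC(∂C) ∪ jW(∂W)` (`riemannianMeasure_image_boundary_eq_zero`), transfer `|W|²` pointwise along the
pieces (`weylNormSq_eq_of_pullbackBilin_eq` with `k = id`), and bound each open piece by the piece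
inequality `setLIntegral_image_interior_le`. (The seam hypothesis is not needed for the inequality.)
[cite: Federer1969, §2.10.11] [cite: Lee2018, Prop. 2.51] [cite: ONeill1983, Ch. 3, Prop. 3.59] -/
theorem stub_weylAdditivity :
    ∀ (C : Type) [TopologicalSpace C] [T2Space C] [SecondCountableTopology C]
      [ChartedSpace (EuclideanHalfSpace 4) C] [IsManifold (𝓡∂ 4) ∞ C] [CompactSpace C]
      (W : Type) [TopologicalSpace W] [T2Space W] [SecondCountableTopology W]
      [ChartedSpace (EuclideanHalfSpace 4) W] [IsManifold (𝓡∂ 4) ∞ W] [CompactSpace W]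
      (P : Type) [TopologicalSpace P] [T2Space P] [SecondCountableTopology P]
      [ChartedSpace (EuclideanSpace ℝ (Fin 4)) P] [IsManifold (𝓡 4) ∞ P]
      (jC : C → P) (jW : W → P)
      (gC : Literature.Geometry.Lorentzian.PseudoRiemannianMetric (𝓡∂ 4) ∞ (EuclideanSpace ℝ (Fin 4))
        (TangentSpace (𝓡∂ 4) : C → Type _)) [gC.HasLeviCivita]
      (gW : Literature.Geometry.Lorentzian.PseudoRiemannianMetric (𝓡∂ 4) ∞ (EuclideanSpace ℝ (Fin 4))
        (TangentSpace (𝓡∂ 4) : W → Type _)) [gW.HasLeviCivita]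
      (g : Literature.Geometry.Lorentzian.PseudoRiemannianMetric (𝓡 4) ∞ (EuclideanSpace ℝ (Fin 4))
        (TangentSpace (𝓡 4) : P → Type _)) [g.HasLeviCivita],
      Manifold.IsSmoothEmbedding (𝓡∂ 4) (𝓡 4) ∞ jC →
      Manifold.IsSmoothEmbedding (𝓡∂ 4) (𝓡 4) ∞ jW →
      Set.range jC ∪ Set.range jW = Set.univ →
      (∀ c w, jC c = jW w → c ∈ (𝓡∂ 4).boundary C) →
      gC.IsRiemannian → gW.IsRiemannian → g.IsRiemannian →
      (∀ c, Literature.Geometry.Lorentzian.pullbackBilin (I := 𝓡 4) (I' := 𝓡∂ 4) jC g.val c = gC.val c) →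
      (∀ w, Literature.Geometry.Lorentzian.pullbackBilin (I := 𝓡 4) (I' := 𝓡∂ 4) jW g.val w = gW.val w) →
      g.weylEnergy ≤ gC.weylEnergy + gW.weylEnergy := by
  intro C _ _ _ _ _ _ W _ _ _ _ _ _ P _ _ _ _ _ jC jW gC _ gW _ g _ hjC hjW hcov _hseam hgC hgW hg
    hisoC hisoW
  -- smoothness, injectivity of the differentials, injectivity of the embeddings
  have hjCs : ContMDiff (𝓡∂ 4) (𝓡 4) ∞ jC := hjC.contMDiff
  have hjWs : ContMDiff (𝓡∂ 4) (𝓡 4) ∞ jW := hjW.contMDiff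
  have hjC' : ∀ c, Injective (mfderiv (𝓡∂ 4) (𝓡 4) jC c) := fun c ↦
    injective_mfderiv_of_isImmersionAt' (hjC.isImmersion.isImmersionAt c)
  have hjW' : ∀ w, Injective (mfderiv (𝓡∂ 4) (𝓡 4) jW w) := fun w ↦
    injective_mfderiv_of_isImmersionAt' (hjW.isImmersion.isImmersionAt w)
  -- measurable structures: Borel; `P` is locally compact, hence `T₃`
  letI : MeasurableSpace P := borel P
  haveI : BorelSpace P := ⟨rfl⟩
  letI : MeasurableSpace C := borel C
  haveI : BorelSpace C := ⟨rfl⟩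
  letI : MeasurableSpace W := borel W
  haveI : BorelSpace W := ⟨rfl⟩
  haveI : LocallyCompactSpace P := Manifold.locallyCompact_of_finiteDimensional (𝓡 4)
  set μg := riemannianMeasure (g.toContMDiffRiemannianMetric hg) with hμg
  set μC := riemannianMeasure (gC.toContMDiffRiemannianMetric hgC) with hμC
  set μW := riemannianMeasure (gW.toContMDiffRiemannianMetric hgW) with hμW
  set fg : P → ℝ≥0∞ := fun x ↦ ENNReal.ofReal (g.weylNormSq x) with hfg
  set fC : C → ℝ≥0∞ := fun c ↦ ENNReal.ofReal (gC.weylNormSq c) with hfC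
  set fW : W → ℝ≥0∞ := fun w ↦ ENNReal.ofReal (gW.weylNormSq w) with hfW
  rw [g.weylEnergy_eq hg, gC.weylEnergy_eq hgC, gW.weylEnergy_eq hgW]
  change ∫⁻ x, fg x ∂μg ≤ ∫⁻ c, fC c ∂μC + ∫⁻ w, fW w ∂μW
  -- pointwise transfer of `|W|²` along the pieces (naturality, with `k = id` on the piece)
  have hidC : ∀ c, Injective (mfderiv (𝓡∂ 4) (𝓡∂ 4) (id : C → C) c) := fun c ↦ by
    rw [mfderiv_id]; exact injective_id
  have hidW : ∀ w, Injective (mfderiv (𝓡∂ 4) (𝓡∂ 4) (id : W → W) w) := fun w ↦ by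
    rw [mfderiv_id]; exact injective_id
  have hisoC' : ∀ c, pullbackBilin (I := 𝓡 4) (I' := 𝓡∂ 4) jC g.val c =
      pullbackBilin (I := 𝓡∂ 4) (I' := 𝓡∂ 4) (id : C → C) gC.val c := fun c ↦ by
    rw [pullbackBilin_id]; exact hisoC c
  have hisoW' : ∀ w, pullbackBilin (I := 𝓡 4) (I' := 𝓡∂ 4) jW g.val w =
      pullbackBilin (I := 𝓡∂ 4) (I' := 𝓡∂ 4) (id : W → W) gW.val w := fun w ↦ by
    rw [pullbackBilin_id]; exact hisoW w
  have hfgC : ∀ c, fg (jC c) = fC c := fun c ↦ by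
    show ENNReal.ofReal (g.weylNormSq (jC c)) = ENNReal.ofReal (gC.weylNormSq c)
    rw [← weylNormSq_eq_of_pullbackBilin_eq g gC hg hgC hjCs hjC' contMDiff_id hidC hisoC' c]
    rfl
  have hfgW : ∀ w, fg (jW w) = fW w := fun w ↦ by
    show ENNReal.ofReal (g.weylNormSq (jW w)) = ENNReal.ofReal (gW.weylNormSq w)
    rw [← weylNormSq_eq_of_pullbackBilin_eq g gW hg hgW hjWs hjW' contMDiff_id hidW hisoW' w]
    rfl
  -- the pieces
  set A : Set C := (𝓡∂ 4).interior C with hA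
  set B : Set W := (𝓡∂ 4).interior W with hB
  -- the piece inequalities
  have hIC : ∫⁻ x in jC '' A, fg x ∂μg ≤ ∫⁻ c, fC c ∂μC :=
    setLIntegral_image_interior_le hgC hg hjCs hjC' hjC.isEmbedding.injective hisoC hfgC
  have hIW : ∫⁻ x in jW '' B, fg x ∂μg ≤ ∫⁻ w, fW w ∂μW :=
    setLIntegral_image_interior_le hgW hg hjWs hjW' hjW.isEmbedding.injective hisoW hfgW
  -- the seams are null
  have hZ : μg (jC '' (𝓡∂ 4).boundary C ∪ jW '' (𝓡∂ 4).boundary W) = 0 := by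
    rw [measure_union_null_iff]
    exact ⟨riemannianMeasure_image_boundary_eq_zero _ (hjCs.of_le (by norm_num)),
      riemannianMeasure_image_boundary_eq_zero _ (hjWs.of_le (by norm_num))⟩
  -- `P` is covered by the two open pieces and the seams
  have hcov' : (univ : Set P) =
      (jC '' A ∪ jW '' B) ∪ (jC '' (𝓡∂ 4).boundary C ∪ jW '' (𝓡∂ 4).boundary W) := by
    refine (eq_univ_of_forall fun y ↦ ?_).symm
    have hy : y ∈ range jC ∪ range jW := by rw [hcov]; exact mem_univ y
    rcases hy with ⟨c, rfl⟩ | ⟨w, rfl⟩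
    · rcases (𝓡∂ 4).isInteriorPoint_or_isBoundaryPoint c with hc | hc
      · exact Or.inl (Or.inl ⟨c, hc, rfl⟩)
      · exact Or.inr (Or.inl ⟨c, hc, rfl⟩)
    · rcases (𝓡∂ 4).isInteriorPoint_or_isBoundaryPoint w with hw | hw
      · exact Or.inl (Or.inr ⟨w, hw, rfl⟩)
      · exact Or.inr (Or.inr ⟨w, hw, rfl⟩)
  calc ∫⁻ x, fg x ∂μg = ∫⁻ x in univ, fg x ∂μg := by rw [Measure.restrict_univ]
    _ ≤ ∫⁻ x in jC '' A ∪ jW '' B, fg x ∂μg +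
        ∫⁻ x in jC '' (𝓡∂ 4).boundary C ∪ jW '' (𝓡∂ 4).boundary W, fg x ∂μg := by
        rw [hcov']; exact lintegral_union_le _ _ _
    _ = ∫⁻ x in jC '' A ∪ jW '' B, fg x ∂μg := by
        rw [setLIntegral_measure_zero _ _ hZ, add_zero]
    _ ≤ ∫⁻ x in jC '' A, fg x ∂μg + ∫⁻ x in jW '' B, fg x ∂μg := lintegral_union_le _ _ _
    _ ≤ ∫⁻ c, fC c ∂μC + ∫⁻ w, fW w ∂μW := add_le_add hIC hIW

end Summit.SmoothPoincare4.SmoothPoincare4.Theorems.CorkRegluingBudget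

end
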